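import Summits.QuantumFields.YangMills.Theorems.FibreConvexityTailDefs
import Summits.QuantumFields.YangMills.Theorems.PoincareLipschitzTwoSidedOfConcentrationStep
import Summits.QuantumFields.YangMills.Theses.PoincareLipschitz
import HarnessLib

/-!
# LINE 27 «MedianCentring» — support workfile: the MARKOV DIRECTION (critic #320, price P2)

`quantileDeviation_of_meanDeviation : PoincareLipschitz.MeanDeviationL → (Q)` — the 3/4-quantile statement (Q) of the registered skeleton
`Lines/median_centring.lean` (stub `stub_quantileDeviation`, text verbatim below) FOLLOWS from the first-moment crux of record by Markov's
inequality at the shifted profile `b₀/16` (`θBal` is linear in `b₀`).  Sorry-free; makes (Q) officially `≤ MeanDeviationL` in the tree's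
vocabulary.  Nothing else is claimed: (Q), MeanDeviationL, HistoryTailL, the rung R3 (YM₃ on T³; NOT d = 4, NOT Clay) all remain OPEN.
-/

open MeasureTheory
open Literature.MathematicalPhysics.QuantumFieldTheory.Balaban1983to89
open Literature.MathematicalPhysics.QuantumFieldTheory.Balaban1983to89.T3ContinuumYM3Torus
open Literature.MathematicalPhysics.QuantumFieldTheory.Balaban1983to89.T3UnitScaleTilt
open Literature.MathematicalPhysics.QuantumFieldTheory.Balaban1983to89.T3UnitLawDensityEML (ℰp measurableE_ℰp)

namespace Summit.QuantumFields.YangMills.Cruxes.HistoryTailL.MedianCentring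

/-- `θBal` is linear in the profile constant `b₀`: dividing `b₀` by `c` divides the threshold by `c`. -/
theorem θBal_div_profile (L : ℕ) (γ b₀ p₀ c : ℝ) (i : ℕ) :
    θBal L γ (b₀ / c) p₀ i = θBal L γ b₀ p₀ i / c := by
  unfold θBal B10.pFun
  ring

/-- **P2 (critic #320): the Markov direction `MeanDeviationL → (Q)`.**  The conclusion is the text of
`stub_quantileDeviation` of `Cruxes/HistoryTailL/Lines/median_centring.lean` verbatim. -/
theorem quantileDeviation_of_meanDeviation
    (hM : Summit.QuantumFields.YangMills.Theses.PoincareLipschitz.MeanDeviationL) :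
    ∀ (L : ℕ) (b₀ p₀ : ℝ), 0 < b₀ → 2 < p₀ → ∃ γ₁ : ℝ, 0 < γ₁ ∧ γ₁ ≤ 1 ∧ ∀ (F : T3Family) (γ : ℝ), F.L = L → 0 < γ → γ ≤ γ₁ →
          ∀ (K j : ℕ), 1 ≤ j → j + 2 ≤ K → ∀ a : Plaq (F.P K) j,
            3 / 4 ≤ (gibbsK F ℰp γ K).real {U : GaugeField (F.P K) 0 (Matrix.specialUnitaryGroup (Fin 2) ℂ) | GaugeGroup.dist1 (GaugeField.plaqHol (Averaging.iter (fun i' => BlockAveraging.blockAvg (P := F.P K) (j := i') ℰp) j U) a) ≤ θBal F.L γ b₀ p₀ (K - j) / 8} := by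
  intro L b₀ p₀ hb₀ hp₀
  obtain ⟨γ₁, hγ₁, hγ₁1, H⟩ := hM L (b₀ / 16) p₀ (by positivity) hp₀
  refine ⟨γ₁, hγ₁, hγ₁1, ?_⟩
  intro F γ hFL hγ hγγ₁ K j hj hjK a
  have hmean := H F γ hFL hγ hγγ₁ K j hj (by omega) a
  rw [θBal_div_profile] at hmean
  -- abbreviations
  set μ := gibbsK F ℰp γ K with hμ
  set θ := θBal F.L γ b₀ p₀ (K - j) with hθ
  haveI : IsProbabilityMeasure μ := isProbabilityMeasure_gibbsK F ℰp hγ.le K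
  have hL1 : 1 ≤ F.L := le_of_lt F.hL.2
  have hθpos : 0 < θ :=
    T3MinimiserStabilityReduction.θBal_pos hL1 hγ (hγγ₁.trans hγ₁1) hb₀ p₀ (K - j)
  set f : GaugeField (F.P K) 0 (Matrix.specialUnitaryGroup (Fin 2) ℂ) → ℝ := fun U =>
    GaugeGroup.dist1 (GaugeField.plaqHol (Averaging.iter (fun i' => BlockAveraging.blockAvg (P := F.P K) (j := i') ℰp) j U) a) with hf
  have hf_meas : Measurable f := Summit.QuantumFields.YangMills.Theorems.FibreConvexityTail.measurable_dist1_plaqHol_iter F K j a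
  have hf_nn : 0 ≤ᵐ[μ] f := ae_of_all _ (fun U => GaugeGroup.dist1_nonneg _)
  have hf_bd : ∀ᵐ U ∂μ, ‖f U‖ ≤ (2 : ℝ) := ae_of_all _ (fun U => by
    rw [Real.norm_eq_abs, abs_of_nonneg (GaugeGroup.dist1_nonneg _)]
    exact Literature.MathematicalPhysics.QuantumFieldTheory.Balaban1983to89.T4PairDerivBridge.dist1_le_two_specialUnitaryGroup _)
  have hf_int : Integrable f μ := Integrable.mono' (integrable_const (2 : ℝ)) hf_meas.aestronglyMeasurable hf_bd
  -- Markov at level θ/8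
  have hmarkov : θ / 8 * μ.real {U | θ / 8 ≤ f U} ≤ ∫ U, f U ∂μ :=
    mul_meas_ge_le_integral_of_nonneg hf_nn hf_int (θ / 8)
  have hint : ∫ U, f U ∂μ ≤ θ / 16 / 2 := hmean
  have h1 : μ.real {U | θ / 8 ≤ f U} ≤ 1 / 4 := by
    have h := hmarkov.trans hint
    by_contra hcon
    rw [not_le] at hcon
    nlinarith [hθpos, hcon, h]
  -- pass to the complement
  have hS : MeasurableSet {U | f U ≤ θ / 8} := measurableSet_le hf_meas measurable_const
  have hsub : {U | f U ≤ θ / 8}ᶜ ⊆ {U | θ / 8 ≤ f U} := by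
    intro U hU
    simp only [Set.mem_compl_iff, Set.mem_setOf_eq, not_le] at hU
    exact hU.le
  have h2 : μ.real {U | f U ≤ θ / 8}ᶜ ≤ 1 / 4 := (measureReal_mono hsub).trans h1
  have h3 : μ.real {U | f U ≤ θ / 8} + μ.real {U | f U ≤ θ / 8}ᶜ = 1 := by
    rw [measureReal_add_measureReal_compl hS, probReal_univ]
  have h4 : 3 / 4 ≤ μ.real {U | f U ≤ θ / 8} := by linarith
  simpa [hf, hθ, hμ] using h4

end Summit.QuantumFields.YangMills.Cruxes.HistoryTailL.MedianCentring
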